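import Summits.ABC.IUTFork.Conditional.AbcOfSHvolGenuineFamily
import Summits.ABC.IUTFork.Conditional.AbcOfSHvolAdmissibleDegTwo
import Literature.IUT.LogVolume.Corollary22PrimeChoiceEffective
import Literature.IUT.LogVolume.Corollary22FullGaloisImage
import HarnessLib

/-!
# Branch C, TARGET #1 (`hvol` / `hreg`): the CONE binder on an ADMISSIBLE degree-2 family with the prime `l` INSIDE
# print's (P1) window — the necessity certificate with every hypothesis of [IUTchIV] Cor. 2.2 (ii) DISCHARGED
# (abc-iut cell, R2 S-chain team, seat abc-iut-s2-p3 gen 2)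

Record-only PROOF file (D-0012) of the abc-iut cell; TAKES NO SIDE on [IUTchIII] Cor. 3.12 or [IUTchIV] Thm. 1.10.
S. Mochizuki, *IUT IV* [Mochizuki2012], Cor. 2.2 (ii), proof pp. 44–46: (P1) «`h^{1/2} ≤ l ≤ 10δ·h^{1/2}·log(2δ·h)`»,
(P2) «`l` does not divide any nonzero `h_v`», (P5), (P6); Thm. 1.10 proof Step (v) pp. 27–28 (the symmetrisation in
`i† ∈ I`). [claim: Mochizuki2012, status: disputed] for every IUT quotation; the content of THIS file is classical.

CONTEXT. The TARGET #1 certificate of record (abc-iut-s2-ref FINAL board 2026-08-26T11:10:58Z) reads the CONE binder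
`hvol : ∀ P ∈ UP, ∀ l prime ≥ 5, AdmitsCore → CondP2 → CondP5 → CondP6 → Cor22.HullVolumeAtDatum P l B_III(P,l)` of
`Conditional.abc_of_S_v3` (p430884; v4 `hreg`) as «Szpiro-type in both directions». Every landed NECESSITY brick is
either a `∀`-statement over admissible `(λ, l)` (abc-iut-s2-p1 p438393/p438715, abc-iut-s2-p5 p435094) or carries
(P2)/(P6) as HYPOTHESES at the exhibited `d_mod = 2` points (abc-iut-s2-p3 gen 0, p438255: «(P2)/(P6) stay hypotheses
(no size link to M)»); and where admissibility IS a kernel fact through `Cor22.condP2_of_lt` (`l > [F:ℚ]·h/log 2`,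
abc-iut-s2-p5 p442698 `QuadWitness.exists_admissible_two_le_dmod`) the necessity inequality `(l+1)·M·log p/48 ≤ B_III`
is content-free (`B_III ⊇ (l+1)/4·(20/3)·log(d*l)·π(d*l) ≫ l·h`). Content lives in print's (P1) WINDOW `l ≍ h^{1/2}`.
THIS FILE puts the prime there:

* `Cor22Window.exists_admissible_prime_window` — for every compactly bounded `K_V` (`CBData D`) and degree bound `d`
  there is `H₀` (= `max(H_K(D), 64)`, `H_K` from the tree's PROVED (P4) ⟹ (P6) `Cor22.condP6_of_seven_le`) such that
  every `P ∈ UP ∩ K_V` of degree `≤ d` with a pole of `j(λ)` at a place over an odd prime `p < h^{1/2}` and `h = log(q^∀) > H₀`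
  admits a prime `l ≥ 7`, `l ≠ p`, with (P2), (P5), (P6) AND `h^{1/2} ≤ l ≤ 10δ_d·h^{1/2}·log(2δ_d·h)` (the tree's
  EFFECTIVE prime choice `Cor22.exists_prime_P1_P2_P3_point_of_five_le_sqrt`, abc-iut S chain) — any degree;
* **`Conditional.splitDepth_window_of_hvol`** — `hvol` VERBATIM + a quadratic point `(F, λ) ∈ UP ∩ K_V` with
  `ℚ(j(λ)) = F`, two places `v₀ ≠ w` over an odd prime `p`, `ord_{v₀} j(λ) ≤ −2M`, `0 ≤ ord_w j(λ)`, `h > H₀`, `p < h^{1/2}`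
  ⟹ ∃ `l` WINDOW-ADMISSIBLE as above with `(l+1)·M·log p/48 ≤ B_III((F,λ), l)` (abc-iut-s2-p3 gen 0's
  `PointDict.splitDepth_le_of_hullVolumeAtDatum`, abc-iut-L5-t7's `ThetaPartII.stub_thetaData`) — NO admissibility
  hypothesis is left;
* **`Conditional.splitDepthWindow_quadWitness_of_hvol`** — at abc-iut-s2-p5's admissible degree-2 family
  `P_k = (ℚ(√2), 1/2 + 2/(3+√2)^k)` (p441759/p442698: `K_V = CBData.std {2}`, the MIXED prime `7 = 𝔭𝔭'`,
  `ord_𝔭 j(λ_k) ≤ −2k`, `ord_{𝔭'} j(λ_k) = 0`): `hvol` ⟹ ∃ `k₀` ∀ `k ≥ k₀` ∃ `l` window-admissible at `P_k` with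
  `(l+1)·k·log 7/48 ≤ B_III(P_k, l)` (`d_mod(P_k) = 2` substituted), and the same divided through:
  `k·log 7/12 − E(l) ≤ (1 + 24/l)·(log-diff(P_k) + log-cond^{∤{2,l}}(λ_k))`,
  `E(l) = 2·log l + 52 + (20/3)·log(d*·l)·π(d*·l)`, `d* = 2^13·3^3·5`, with `h_k^{1/2} ≤ l ≤ 10δ₂·h_k^{1/2}·log(2δ₂·h_k)`.

READING (for the planners; nothing asserted about print or any author). With `l` in the (P1) window, `E(l) = O(l) =
O(h_k^{1/2}·log h_k)` (Chebyshev), while `k·log 2 ≤ h_k` (`QuadWitness.le_logQAvoid_P`); so the CONE binder asserts, on an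
explicit infinite family where admissibility is a THEOREM, a lower bound for `log-diff + log-cond` LINEAR in the depth `k` up to
an error of lower order — an effective Szpiro/abc-type statement about `λ_k(1 − λ_k)`, `λ_k = 1/2 + 2/(3+√2)^k`, open in
print. This closes the «no size link to M» gap of p438255: the obstruction certificate is Szpiro-type AND inhabited with
content. The explicit `O(h^{1/2}·log h)` form is filed separately. HONEST SCOPE: consequences of the typed binder;
typed ≠ proved; no side taken. PROOF-ONLY file: no definitions, no `Prop` facts.
[cite: Mochizuki2012, IUTchIV Cor. 2.2 (ii) proof (P1)–(P7) p. 44–46] [cite: Mochizuki2012, IUTchIV Thm. 1.10 Step (v) p. 27–28]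
[cite: MochizukiGenEll2010, Ex 1.3 (ii) p.5] [cite: DupuyHilado2025, §3.3, §3.6, §4.7]
-/

noncomputable section

namespace Summit.ABC.IUTFork

open NumberField IsDedekindDomain Literature.IUT.LogVolume Literature.IUT.HodgeTheaters
open Literature.NumberTheory.DiophantineGeometry.GenEll
open scoped Classical

/-! ## §1. A window-admissible prime at a compactly bounded point of any degree -/

namespace Cor22Window

/-- **WINDOW-ADMISSIBLE PRIMES EXIST at every high point of a compactly bounded set (any degree).** For a compactly
bounded `K_V` (`D : CBData`) and a degree bound `d` there is `H₀` such that: for every `P = (F, λ) ∈ UP ∩ K_V` with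
`[F:ℚ] ≤ d`, every place `V` of `F` over an ODD prime `p` at which `j(λ)` has a pole, if `h := log(q^∀(λ)) > H₀` and
`p < h^{1/2}`, then some prime `l` satisfies `7 ≤ l`, `l ≠ p`, (P2) `Cor22.CondP2 P l`, (P5) `Cor22.CondP5 P l` (witnessed by
`V ∤ 2l`), (P6) `Cor22.CondP6 P l`, and the (P1) window `h^{1/2} ≤ l ≤ 10·δ_d·h^{1/2}·log(2·δ_d·h)`. Assembly of the tree's
`Cor22.exists_prime_P1_P2_P3_point_of_five_le_sqrt` (effective (P1)(P2)(P3)) and `Cor22.condP6_of_seven_le` ((P4) ⟹ (P6),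
proved); `H₀ = max(H_K(D), 64)`. [cite: Mochizuki2012, IUTchIV Cor. 2.2 (ii) proof (P1)–(P6) p. 44–46] -/
theorem exists_admissible_prime_window (D : CBData) (d : ℕ) :
    ∃ H₀ : ℝ, ∀ (P : NFPoint), P ∈ UP → P ∈ D.toSet → P.degree ≤ d →
      ∀ {p : ℕ} [Fact p.Prime] (V : placesOver P.F p), p ≠ 2 → ord P.F V.1 (Cor22.jInv P.x) < 0 →
      H₀ < Cor22.logQForall P → (p : ℝ) < Real.sqrt (Cor22.logQForall P) →
      ∃ l : ℕ, l.Prime ∧ 7 ≤ l ∧ l ≠ p ∧ Cor22.CondP2 P l ∧ Cor22.CondP5 P l ∧ Cor22.CondP6 P l ∧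
        Real.sqrt (Cor22.logQForall P) ≤ l ∧
        (l : ℝ) ≤ 10 * Cor22.delta d * Real.sqrt (Cor22.logQForall P) *
          Real.log (2 * Cor22.delta d * Cor22.logQForall P) := by
  obtain ⟨HK, hHK⟩ := Cor22.condP6_of_seven_le D
  refine ⟨max HK 64, fun P hUP hmem hdeg p _ V hp2 hV hH hp => ?_⟩
  have hHK' : HK < Cor22.logQForall P := lt_of_le_of_lt (le_max_left _ _) hH
  have h64 : (64 : ℝ) < Cor22.logQForall P := lt_of_le_of_lt (le_max_right _ _) hH
  -- `8 < h^{1/2}`, so the window prime is `≥ 9 ≥ 7` and `5 ≤ h^{1/2}`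
  have h8 : (8 : ℝ) < Real.sqrt (Cor22.logQForall P) := by
    rw [show (8 : ℝ) = Real.sqrt (8 ^ 2) by rw [Real.sqrt_sq (by norm_num)]]
    exact Real.sqrt_lt_sqrt (by norm_num) (by norm_num; exact h64)
  have h5 : (5 : ℝ) ≤ Real.sqrt (Cor22.logQForall P) := by linarith
  obtain ⟨l, hlp, hP1lo, hP1hi, hP2, -⟩ := Cor22.exists_prime_P1_P2_P3_point_of_five_le_sqrt P hdeg h5
  have hl9 : 9 ≤ l := by
    have : (8 : ℝ) < l := h8.trans_le hP1lo
    exact_mod_cast this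
  have hl7 : 7 ≤ l := by omega
  have hlp' : l ≠ p := by
    intro h
    have : (p : ℝ) < (l : ℝ) := hp.trans_le hP1lo
    rw [h] at this
    exact lt_irrefl _ this
  -- (P5) at the pole `V ∤ 2l`
  have hP5 : Cor22.CondP5 P l :=
    ⟨V.1, hV, SplitDepth.natCast_not_mem_of_prime_ne V Nat.prime_two (Ne.symm hp2),
      SplitDepth.natCast_not_mem_of_prime_ne V hlp hlp'⟩
  have hP6 : Cor22.CondP6 P l := hHK P hmem hUP l hlp hl7 hP2 hP5 hHK'
  exact ⟨l, hlp, hl7, hlp', hP2, hP5, hP6, hP1lo, hP1hi⟩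

end Cor22Window

/-! ## §2. The CONE binder on a window-admissible quadratic split-depth point -/

namespace Conditional

open PointDict

/-- **THE CONE BINDER `hvol` AT A WINDOW-ADMISSIBLE QUADRATIC SPLIT-DEPTH POINT — no admissibility hypothesis left.**
Assume `hvol` VERBATIM (`Conditional.abc_of_S_v3`, p430884 l. 375–381). For a compactly bounded `K_V` (`D : CBData`) there is
`H₀` such that: for every quadratic field `F`, every `λ ∈ F` with `P := (F, λ) ∈ UP ∩ K_V`, `ℚ(j(λ)) = F`, `P` admitting a core,
every odd prime `p` under two distinct places `v₀ ≠ w` of `F` with `ord_{v₀} j(λ) ≤ −2M` (`M ≥ 1`) and `0 ≤ ord_w j(λ)`, if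
`h = log(q^∀(λ)) > H₀` and `p < h^{1/2}`, then THERE IS a prime `l ≥ 7`, `l ≠ p`, with (P2), (P5), (P6) at `(P, l)`, inside the
(P1) window `h^{1/2} ≤ l ≤ 10δ₂·h^{1/2}·log(2δ₂·h)`, at which `(l+1)·M·log p/48 ≤ B_III(P, l)`. (§1 + abc-iut-s2-p3 gen 0's
`PointDict.splitDepth_le_of_hullVolumeAtDatum` on the genuine datum of `ThetaPartII.stub_thetaData`.) Nothing asserted about
any point or about print; no side taken. [cite: Mochizuki2012, IUTchIV Cor. 2.2 (ii) proof (P1)–(P7) p. 44–46]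
[cite: Mochizuki2012, IUTchIV Thm. 1.10 Step (v) p. 27–28] [claim: Mochizuki2012, status: disputed] -/
theorem splitDepth_window_of_hvol
    (hvol : ∀ P₀ : NFPoint, P₀ ∈ UP → ∀ l : ℕ, l.Prime → 5 ≤ l →
      Cor22.AdmitsCore P₀ → Cor22.CondP2 P₀ l → Cor22.CondP5 P₀ l → Cor22.CondP6 P₀ l →
        Cor22.HullVolumeAtDatum P₀ l (((l : ℝ) + 1) / 4 *
          ((1 + 12 * (Cor22.dmod P₀ : ℝ) / l) * (P₀.logDiff + Cor22.logCondAvoid P₀ {2, l})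
            + 2 * Real.log l + 52
            + 20 / 3 * Real.log (((2 ^ 12 * 3 ^ 3 * 5 * Cor22.dmod P₀ : ℕ) : ℝ) * (l : ℝ))
              * (Nat.primeCounting (2 ^ 12 * 3 ^ 3 * 5 * Cor22.dmod P₀ * l) : ℝ))))
    (D : CBData) :
    ∃ H₀ : ℝ, ∀ {F : Type} [Field F] [NumberField F], Module.finrank ℚ F = 2 → ∀ (x : F),
      NFPoint.mk F x ∈ UP → NFPoint.mk F x ∈ D.toSet →
      IntermediateField.adjoin ℚ ({Cor22.jInv x} : Set F) = ⊤ → Cor22.AdmitsCore (NFPoint.mk F x) →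
      ∀ {p : ℕ} [Fact p.Prime], p ≠ 2 → ∀ (v₀ w : placesOver F p), w ≠ v₀ → ∀ {M : ℕ}, 1 ≤ M →
      ord F v₀.1 (Cor22.jInv x) ≤ -(2 * M : ℤ) → 0 ≤ ord F w.1 (Cor22.jInv x) →
      H₀ < Cor22.logQForall (NFPoint.mk F x) → (p : ℝ) < Real.sqrt (Cor22.logQForall (NFPoint.mk F x)) →
      ∃ l : ℕ, l.Prime ∧ 7 ≤ l ∧ l ≠ p ∧ Cor22.CondP2 (NFPoint.mk F x) l ∧ Cor22.CondP5 (NFPoint.mk F x) l ∧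
        Cor22.CondP6 (NFPoint.mk F x) l ∧
        Real.sqrt (Cor22.logQForall (NFPoint.mk F x)) ≤ l ∧
        (l : ℝ) ≤ 10 * Cor22.delta 2 * Real.sqrt (Cor22.logQForall (NFPoint.mk F x)) *
          Real.log (2 * Cor22.delta 2 * Cor22.logQForall (NFPoint.mk F x)) ∧
        ((l : ℝ) + 1) * M * Real.log p / 48 ≤
          ((l : ℝ) + 1) / 4 *
            ((1 + 12 * (Cor22.dmod (NFPoint.mk F x) : ℝ) / l) *
                ((NFPoint.mk F x).logDiff + Cor22.logCondAvoid (NFPoint.mk F x) {2, l})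
              + 2 * Real.log l + 52
              + 20 / 3 * Real.log (((2 ^ 12 * 3 ^ 3 * 5 * Cor22.dmod (NFPoint.mk F x) : ℕ) : ℝ) * (l : ℝ))
                * (Nat.primeCounting (2 ^ 12 * 3 ^ 3 * 5 * Cor22.dmod (NFPoint.mk F x) * l) : ℝ)) := by
  obtain ⟨H₀, hH₀⟩ := Cor22Window.exists_admissible_prime_window D 2
  refine ⟨H₀, fun {F} _ _ hF x hUP hmem htop hcore {p} _ hp2 v₀ w hvw {M} hM hjv hjw hH hp => ?_⟩
  have hdeg : (NFPoint.mk F x).degree ≤ 2 := by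
    change Module.finrank ℚ F ≤ 2
    rw [hF]
  have hneg : ord F v₀.1 (Cor22.jInv x) < 0 := by omega
  obtain ⟨l, hlp, hl7, hlp', hP2, hP5, hP6, hlo, hhi⟩ :=
    hH₀ (NFPoint.mk F x) hUP hmem hdeg v₀ hp2 hneg hH hp
  obtain ⟨T⟩ := Summit.ABC.ABC.Theorems.ThetaPartII.stub_thetaData _ hUP l hlp (by omega) hcore hP2 hP5 hP6
  have h := hvol _ hUP l hlp (by omega) hcore hP2 hP5 hP6
  have h2 : ((2 : ℕ) : 𝓞 F) ∉ v₀.1.asIdeal := SplitDepth.natCast_not_mem_of_prime_ne v₀ Nat.prime_two (Ne.symm hp2)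
  have hl : ((l : ℕ) : 𝓞 F) ∉ v₀.1.asIdeal := SplitDepth.natCast_not_mem_of_prime_ne v₀ hlp hlp'
  obtain ⟨hn1, -⟩ := SplitDepth.localDegree_eq_one hF v₀ w hvw
  obtain ⟨hwt1, hlog⟩ := SplitDepth.weight_eq_half_and_logNorm_eq hF v₀ w hvw
  obtain ⟨hwt2, -⟩ := SplitDepth.weight_eq_half_and_logNorm_eq hF w v₀ (Ne.symm hvw)
  exact ⟨l, hlp, hl7, hlp', hP2, hP5, hP6, hlo, hhi,
    splitDepth_le_of_hullVolumeAtDatum h T hlp.pos htop v₀.2 w.2 hM hjv hjw h2 hl hwt1 hwt2 hn1 hlog⟩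

/-! ## §3. At abc-iut-s2-p5's admissible degree-2 family `P_k = (ℚ(√2), 1/2 + 2/(3+√2)^k)` -/

/-- `d_mod(P_k) = 2` and `ℚ(j(λ_k)) = ℚ(√2)`: `j(λ_k) ∉ ℚ` (abc-iut-s2-p5's `QuadWitness.two_le_dmod_P`) and `[ℚ(√2):ℚ] = 2`
(abc-iut-s2-p3's `SplitDepth.adjoin_simple_eq_top_of_not_mem_bot`). [cite: MochizukiGenEll2010, Def 1.5 (i) p.8] -/
theorem quadWitness_adjoin_jInv_eq_top {𝔭 𝔭' : HeightOneSpectrum (𝓞 QuadWitness.F)}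
    (ha : QuadWitness.a ∈ 𝔭.asIdeal) (habar : QuadWitness.abar ∈ 𝔭'.asIdeal) (ha' : QuadWitness.a ∉ 𝔭'.asIdeal)
    (h7 : ((7 : ℕ) : 𝓞 QuadWitness.F) ∈ 𝔭.asIdeal) (h7' : ((7 : ℕ) : 𝓞 QuadWitness.F) ∈ 𝔭'.asIdeal)
    {k : ℕ} (hk : 1 ≤ k) :
    IntermediateField.adjoin ℚ ({Cor22.jInv (QuadWitness.lam k)} : Set QuadWitness.F) = ⊤ ∧
      Cor22.dmod (QuadWitness.P k) = 2 := by
  have h2 := QuadWitness.two_le_dmod_P ha habar ha' h7 h7' hk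
  have hnot : Cor22.jInv (QuadWitness.lam k) ∉ (⊥ : IntermediateField ℚ QuadWitness.F) := by
    intro hmem
    have hbot : IntermediateField.adjoin ℚ ({Cor22.jInv (QuadWitness.lam k)} : Set QuadWitness.F) = ⊥ :=
      IntermediateField.adjoin_simple_eq_bot_iff.mpr hmem
    have h1 : Cor22.dmod (QuadWitness.P k) = 1 := by
      change Module.finrank ℚ (IntermediateField.adjoin ℚ ({Cor22.jInv (QuadWitness.lam k)} : Set QuadWitness.F)) = 1
      rw [hbot, IntermediateField.finrank_bot]
    omega
  have htop := SplitDepth.adjoin_simple_eq_top_of_not_mem_bot QuadWitness.finrank_F hnot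
  refine ⟨htop, ?_⟩
  change Module.finrank ℚ (IntermediateField.adjoin ℚ ({Cor22.jInv (QuadWitness.lam k)} : Set QuadWitness.F)) = 2
  rw [htop, IntermediateField.finrank_top', QuadWitness.finrank_F]

/-- **THE CONE BINDER `hvol` ON THE ADMISSIBLE DEGREE-2 FAMILY, PRIME IN THE (P1) WINDOW.** Assume `hvol` VERBATIM. Then there is
`k₀` such that for every `k ≥ k₀` the point `P_k = (ℚ(√2), λ_k)`, `λ_k = 1/2 + 2/(3+√2)^k` (abc-iut-s2-p5: `P_k ∈ UP ∩ K_V`,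
`K_V = CBData.std {2}`, `d_mod = 2`, admitting a core) carries a prime `l ≥ 7`, `l ≠ 7`, with (P2), (P5), (P6) — ALL PROVED — inside
`h_k^{1/2} ≤ l ≤ 10δ₂·h_k^{1/2}·log(2δ₂·h_k)` (`h_k = log(q^∀(λ_k)) ≥ k·log 2`), at which
`(l+1)·k·log 7/48 ≤ B_III(P_k, l) = (l+1)/4·{(1+24/l)(log-diff(P_k) + log-cond^{∤{2,l}}(λ_k)) + 2 log l + 52 + (20/3) log(d*l) π(d*l)}`,
`d* = 2^13·3^3·5`; equivalently `k·log 7/12 − (2 log l + 52 + (20/3) log(d*l) π(d*l)) ≤ (1+24/l)·(log-diff(P_k) + log-cond^{∤{2,l}}(λ_k))`.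
READING: an effective Szpiro/abc-type lower bound, linear in `k` up to `O(l) = O(h_k^{1/2} log h_k)`, for the conductor of the
explicit family `λ_k(1−λ_k)` — asserted by the binder, open in print. Nothing asserted about any point, about print, or
about any author; typed ≠ proved. [cite: Mochizuki2012, IUTchIV Cor. 2.2 (ii) proof (P1)–(P7) p. 44–46]
[cite: Mochizuki2012, IUTchIV Thm. 1.10 Step (v) p. 27–28] [claim: Mochizuki2012, status: disputed] -/
theorem splitDepthWindow_quadWitness_of_hvol
    (hvol : ∀ P₀ : NFPoint, P₀ ∈ UP → ∀ l : ℕ, l.Prime → 5 ≤ l →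
      Cor22.AdmitsCore P₀ → Cor22.CondP2 P₀ l → Cor22.CondP5 P₀ l → Cor22.CondP6 P₀ l →
        Cor22.HullVolumeAtDatum P₀ l (((l : ℝ) + 1) / 4 *
          ((1 + 12 * (Cor22.dmod P₀ : ℝ) / l) * (P₀.logDiff + Cor22.logCondAvoid P₀ {2, l})
            + 2 * Real.log l + 52
            + 20 / 3 * Real.log (((2 ^ 12 * 3 ^ 3 * 5 * Cor22.dmod P₀ : ℕ) : ℝ) * (l : ℝ))
              * (Nat.primeCounting (2 ^ 12 * 3 ^ 3 * 5 * Cor22.dmod P₀ * l) : ℝ)))) :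
    ∃ k₀ : ℕ, ∀ k : ℕ, k₀ ≤ k →
      ∃ l : ℕ, l.Prime ∧ 7 ≤ l ∧ l ≠ 7 ∧ Cor22.CondP2 (QuadWitness.P k) l ∧ Cor22.CondP5 (QuadWitness.P k) l ∧
        Cor22.CondP6 (QuadWitness.P k) l ∧
        Real.sqrt (Cor22.logQForall (QuadWitness.P k)) ≤ l ∧
        (l : ℝ) ≤ 10 * Cor22.delta 2 * Real.sqrt (Cor22.logQForall (QuadWitness.P k)) *
          Real.log (2 * Cor22.delta 2 * Cor22.logQForall (QuadWitness.P k)) ∧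
        (k : ℝ) * Real.log 2 ≤ Cor22.logQForall (QuadWitness.P k) ∧
        ((l : ℝ) + 1) * k * Real.log 7 / 48 ≤
          ((l : ℝ) + 1) / 4 *
            ((1 + 24 / (l : ℝ)) * ((QuadWitness.P k).logDiff + Cor22.logCondAvoid (QuadWitness.P k) {2, l})
              + 2 * Real.log l + 52
              + 20 / 3 * Real.log (((2 ^ 13 * 3 ^ 3 * 5 : ℕ) : ℝ) * (l : ℝ))
                * (Nat.primeCounting (2 ^ 13 * 3 ^ 3 * 5 * l) : ℝ)) ∧
        (k : ℝ) * Real.log 7 / 12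
            - (2 * Real.log l + 52
              + 20 / 3 * Real.log (((2 ^ 13 * 3 ^ 3 * 5 : ℕ) : ℝ) * (l : ℝ))
                * (Nat.primeCounting (2 ^ 13 * 3 ^ 3 * 5 * l) : ℝ)) ≤
          (1 + 24 / (l : ℝ)) * ((QuadWitness.P k).logDiff + Cor22.logCondAvoid (QuadWitness.P k) {2, l}) := by
  haveI h7p : Fact (Nat.Prime 7) := ⟨by norm_num⟩
  obtain ⟨𝔭, 𝔭', ha, habar, ha', -, h7, h7'⟩ := QuadWitness.exists_places
  obtain ⟨H₀, hH₀⟩ := splitDepth_window_of_hvol hvol (CBData.std {2} QuadWitness.hS2)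
  have hlog2 : 0 < Real.log 2 := Real.log_pos (by norm_num)
  -- the two places over `7` as elements of `V(F)_7`
  let v₀ : placesOver QuadWitness.F 7 := ⟨𝔭, Cor22.mem_placesOver_of_natCast_mem 7 𝔭 h7⟩
  let w : placesOver QuadWitness.F 7 := ⟨𝔭', Cor22.mem_placesOver_of_natCast_mem 7 𝔭' h7'⟩
  have hvw : w ≠ v₀ := by
    intro h
    have : 𝔭' = 𝔭 := congrArg Subtype.val h
    exact ha' (this ▸ ha)
  -- `k₀`: `k·log 2 > max(H₀, 49)` and `k ≥ 6`
  refine ⟨max 71 (⌈H₀ / Real.log 2⌉₊ + 1), fun k hk => ?_⟩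
  have hk71 : 71 ≤ k := (le_max_left _ _).trans hk
  have hk6 : 6 ≤ k := by omega
  have hk1 : 1 ≤ k := by omega
  have hkH : H₀ < (k : ℝ) * Real.log 2 := by
    have h1 : H₀ / Real.log 2 ≤ ⌈H₀ / Real.log 2⌉₊ := Nat.le_ceil _
    have h2 : ((⌈H₀ / Real.log 2⌉₊ + 1 : ℕ) : ℝ) ≤ (k : ℝ) := by exact_mod_cast (le_max_right _ _).trans hk
    push_cast at h2
    rw [div_le_iff₀ hlog2] at h1
    nlinarith
  have hlogQ : (k : ℝ) * Real.log 2 ≤ Cor22.logQForall (QuadWitness.P k) :=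
    (QuadWitness.le_logQAvoid_P ha h7 hk1 Nat.prime_three (by norm_num)).trans
      (Cor22.logQAvoid_anti (QuadWitness.P k) (Finset.empty_subset _))
  have hH : H₀ < Cor22.logQForall (QuadWitness.P k) := hkH.trans_le hlogQ
  have h49 : (49 : ℝ) < Cor22.logQForall (QuadWitness.P k) := by
    have h71 : (71 : ℝ) ≤ k := by exact_mod_cast hk71
    have := Real.log_two_gt_d9
    nlinarith
  have hp : ((7 : ℕ) : ℝ) < Real.sqrt (Cor22.logQForall (QuadWitness.P k)) := by
    rw [show ((7 : ℕ) : ℝ) = Real.sqrt (7 ^ 2) by rw [Real.sqrt_sq (by norm_num)]; norm_num]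
    exact Real.sqrt_lt_sqrt (by norm_num) (by norm_num; exact h49)
  obtain ⟨htop, hd⟩ := quadWitness_adjoin_jInv_eq_top ha habar ha' h7 h7' hk1
  have hjv : ord QuadWitness.F v₀.1 (Cor22.jInv (QuadWitness.lam k)) ≤ -(2 * k : ℤ) :=
    QuadWitness.ord_jInv_lam_le ha h7 hk1
  have hjw : 0 ≤ ord QuadWitness.F w.1 (Cor22.jInv (QuadWitness.lam k)) :=
    (QuadWitness.ord_at_good h7' habar ha' k).2.ge
  obtain ⟨l, hlp, hl7, hlp', hP2, hP5, hP6, hlo, hhi, hineq⟩ :=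
    hH₀ QuadWitness.finrank_F (QuadWitness.lam k) (QuadWitness.P_mem_UP ha habar ha' h7 h7' hk6)
      (QuadWitness.P_mem_std hk6) htop (QuadWitness.admitsCore_P ha h7 hk1) (p := 7) (by norm_num) v₀ w hvw hk1 hjv hjw
      hH hp
  -- substitute `d_mod = 2`
  have h7log : Real.log ((7 : ℕ) : ℝ) = Real.log 7 := by norm_num
  rw [h7log, hd] at hineq
  have e1 : (2 ^ 12 * 3 ^ 3 * 5 * 2 : ℕ) = 2 ^ 13 * 3 ^ 3 * 5 := by norm_num
  have e3 : (1 + 12 * ((2 : ℕ) : ℝ) / l) = 1 + 24 / (l : ℝ) := by push_cast; ring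
  rw [e1, e3] at hineq
  refine ⟨l, hlp, hl7, hlp', hP2, hP5, hP6, hlo, hhi, hlogQ, hineq, ?_⟩
  -- divide through by `(l+1)/4 > 0`
  have e4 : ((l : ℝ) + 1) * k * Real.log 7 / 48 = ((l : ℝ) + 1) / 4 * ((k : ℝ) * Real.log 7 / 12) := by ring
  rw [e4] at hineq
  have key := le_of_mul_le_mul_left hineq (by positivity : (0 : ℝ) < ((l : ℝ) + 1) / 4)
  linarith

end Conditional

end Summit.ABC.IUTFork

end
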